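import Mathlib.Topology.MetricSpace.Closeds
import Mathlib.MeasureTheory.Measure.LevyProkhorovMetric
import Mathlib.MeasureTheory.Constructions.BorelSpace.Basic
import Literature.Probability.RandomPlanarGeometry.Curve
import Literature.Probability.RandomPlanarGeometry.CurveSpace
import HarnessLib

-- provenance: harness21/H21/H21/Prelude/Stoch/LoopEnsembleSpace.lean @ 67f5a19 (interim HEAD d8f2665); M5 mechanical rewrite
/-!
# The space of loop collections (CLE / loop-soup carrier)

Trunk `Stoch`, prelude item `LoopEnsembleSpace` (notions `curve_space_mod_reparam` (loop part),
`cle_loop_ensemble`).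

A *loop* is a curve (modulo increasing reparametrisation, `CurveClass E` from
`Literature.Prelude.Stoch.CurveSpace`) whose endpoints agree. Following Aizenman–Burchard and
Camia–Newman, a *collection of loops* is encoded as a closed subset of the metric space
`CurveClass E`, and the space of collections carries the Hausdorff (extended) distance induced
by the curve distance. Laws of conformal loop ensembles, percolation loop soups, etc. are Borel
probability measures on this space; their distance is measured by the Lévy–Prokhorov distance.

## Contents

* `Curve.IsLoop`, `CurveClass.IsLoop`, `CurveClass.IsTrivial` : closed curves; constant loops.
* `LoopSpace E := TopologicalSpace.Closeds (CurveClass E)` with Mathlib's Hausdorff emetric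
  `TopologicalSpace.Closeds.instEMetricSpace` (complete when `CurveClass E` is, by
  `TopologicalSpace.Closeds.instCompleteSpace`), its Borel σ-algebra, and the predicate
  `LoopSpace.IsLoopCollection`.
* `LoopSpace.ofFinset`, `LoopSpace.restrict` (window restriction), `LoopSpace.map`
  (push-forward along a continuous map, for conformal invariance).
* `camiaNewmanEDist` : the Lévy–Prokhorov edistance of laws on `LoopSpace E`
  (Mathlib's `MeasureTheory.levyProkhorovEDist`), a proxy for the Camia–Newman / DKKMO metric.
* `LoopSpace.completeSpace` (from `CurveClass.completeSpace`), `CurveClass.isClosed_setOf_isLoop`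
  (proved).

Sources: M. Aizenman, A. Burchard, *Hölder regularity and dimension bounds for random curves*,
Duke Math. J. 99 (1999), §2; F. Camia, C. M. Newman, *Two-dimensional critical percolation:
the full scaling limit*, Comm. Math. Phys. 268 (2006), §2; H. Duminil-Copin, K. K. Kozlowski,
D. Krachun, I. Manolescu, M. Oulamara, *Rotational invariance in critical planar lattice
models*, arXiv:2012.11672, §1.4.

## Design / Mathlib

* `[MetricSpace E]` throughout (endpoints and traces of curve classes need it).
* `LoopSpace` is an `abbrev` for `TopologicalSpace.Closeds (CurveClass E)`, so Mathlib's
  `Closeds` API (coercion to `Set`, membership, lattice structure, Hausdorff `edist`) applies.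
  Mathlib registers no `MeasurableSpace` on `Closeds`; we register the Borel one here.
  The name shadows Mathlib's root `LoopSpace X x := Path x x` (based loops, homotopy theory)
  inside `namespace Literature` only; here it denotes the space of loop *collections*, as mandated by
  the trunk outline.
* `LoopSpace E` is complete when `E` is (`LoopSpace.completeSpace`, via Mathlib's
  `TopologicalSpace.Closeds.instCompleteSpace`) but it is NOT separable for any `E` of interest:
  already for `E = ℝ` the closed sets `{constant loop at n | n ∈ A}`, `A ⊆ ℕ`, are `2^ℵ₀` points
  at pairwise Hausdorff edistance `≥ 1`. So `LoopSpace E` is not Polish (the outline's planned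
  `LoopSpace.polishSpace` is false and is replaced by `LoopSpace.completeSpace`); laws of loop
  ensembles are Borel probability measures on a complete emetric space, and separability is a
  property of their individual (closed) supports (Camia–Newman work on such a support).
* Only *non-trivial* loops are required to be countable in `IsLoopCollection`: the closure (in
  curve space) of a CLE or of the percolation full scaling limit contains every constant loop at
  every point of the closure of the domain, an uncountable set.
* `camiaNewmanEDist` is Mathlib's Lévy–Prokhorov edistance. DKKMO's `d_CN` is instead an infimum
  over couplings of expected window-restricted Hausdorff distances. `levyProkhorovEDist` is the
  documented v0 proxy for `d_CN` (on separable supports both metrise weak convergence of laws);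
  it is stated for arbitrary measures, like `levyProkhorovEDist`, and applied to probability laws.
-/

open Set Filter Topology MeasureTheory
open scoped ENNReal

namespace Literature.Probability.RandomPlanarGeometry

variable {E : Type*}

namespace Curve

/-- A parametrised curve is a *loop* if it is closed: `γ 0 = γ 1`
(Aizenman–Burchard, Duke Math. J. 99 (1999), §2; Camia–Newman, CMP 268 (2006), §2). [folklore] -/
def IsLoop [TopologicalSpace E] (γ : Curve E) : Prop := γ.source = γ.target

/-- Unfolding `Curve.IsLoop` (Camia–Newman, CMP 268 (2006), §2). [folklore] -/
@[simp] lemma isLoop_iff [TopologicalSpace E] {γ : Curve E} : γ.IsLoop ↔ γ.source = γ.target := Iff.rfl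

end Curve

namespace CurveClass

variable [MetricSpace E] {F : Type*} [MetricSpace F]

/-- A curve class is a *loop* if its (well-defined) endpoints agree
(Aizenman–Burchard, Duke Math. J. 99 (1999), §2; Camia–Newman, CMP 268 (2006), §2). [folklore] -/
def IsLoop (c : CurveClass E) : Prop := c.source = c.target

/-- A curve class is *trivial* if its trace is a single point, i.e. it is the class of a
constant loop (Camia–Newman, CMP 268 (2006), §2: constant loops appear in the closure of the
loop ensemble and are discarded). [folklore] -/
def IsTrivial (c : CurveClass E) : Prop := c.range.Subsingleton

/-- Unfolding `CurveClass.IsLoop` (Camia–Newman, CMP 268 (2006), §2). [folklore] -/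
@[simp] lemma isLoop_iff {c : CurveClass E} : c.IsLoop ↔ c.source = c.target := Iff.rfl

/-- The class of a curve is a loop iff the curve is (Camia–Newman, CMP 268 (2006), §2). [folklore] -/
lemma isLoop_mk {γ : Curve E} : (mk γ).IsLoop ↔ γ.IsLoop := Iff.rfl

/-- Unfolding `CurveClass.IsTrivial` (Camia–Newman, CMP 268 (2006), §2). [folklore] -/
@[simp] lemma isTrivial_iff {c : CurveClass E} : c.IsTrivial ↔ c.range.Subsingleton := Iff.rfl

/-- A trivial curve class is a loop: both endpoints lie on the one-point trace
(Camia–Newman, CMP 268 (2006), §2). [folklore] -/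
lemma IsTrivial.isLoop {c : CurveClass E} (h : c.IsTrivial) : c.IsLoop :=
  h (source_mem_range c) (target_mem_range c)

/-- The set of loops is closed in curve space, as the equaliser of the continuous endpoint maps
(Aizenman–Burchard, Duke Math. J. 99 (1999), §2.1). [folklore] -/
theorem isClosed_setOf_isLoop : IsClosed {c : CurveClass E | c.IsLoop} :=
  isClosed_eq continuous_source continuous_target

/-- Being a loop is a Borel event in curve space (Aizenman–Burchard 1999, §2.1). [cite: AizenmanBurchard1999, §2.1] -/
theorem measurableSet_setOf_isLoop : MeasurableSet {c : CurveClass E | c.IsLoop} :=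
  isClosed_setOf_isLoop.measurableSet

/-- Push-forward along a continuous map sends loops to loops
(Camia–Newman, CMP 268 (2006), §2; conformal invariance of CLE). [folklore] -/
lemma IsLoop.map (f : C(E, F)) {c : CurveClass E} (h : c.IsLoop) :
    (c.map f).IsLoop := by
  rw [isLoop_iff, source_map, target_map, isLoop_iff.1 h]

end CurveClass

/-- The space of loop collections in `E`: closed subsets of the metric space `CurveClass E` of
curves modulo reparametrisation, with the Hausdorff extended metric
(`TopologicalSpace.Closeds.instEMetricSpace`)
(Aizenman–Burchard, Duke Math. J. 99 (1999), §2; Camia–Newman, CMP 268 (2006), §2). [folklore] -/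
abbrev LoopSpace (E : Type*) [MetricSpace E] : Type _ := TopologicalSpace.Closeds (CurveClass E)

namespace LoopSpace

variable [MetricSpace E] {F : Type*} [MetricSpace F]

/-- Loop collections carry the Borel σ-algebra of the Hausdorff topology: laws of loop
ensembles are Borel probability measures on `LoopSpace E` (Camia–Newman, CMP 268 (2006), §2). [folklore] -/
noncomputable instance instMeasurableSpace : MeasurableSpace (LoopSpace E) := borel _

/-- The σ-algebra on loop collections is the Borel σ-algebra (Camia–Newman, CMP 268 (2006),
§2). [folklore] -/
instance instBorelSpace : BorelSpace (LoopSpace E) := ⟨rfl⟩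

/-- A closed set of curve classes is a *loop collection* if all its members are loops and its
non-trivial members form a countable set. Only non-trivial loops are counted: the closure of a
CLE or of the critical-percolation loop ensemble contains every constant loop of the closed
domain (Camia–Newman, CMP 268 (2006), §2; Sheffield, Duke Math. J. 147 (2009), §1). [folklore] -/
def IsLoopCollection (L : LoopSpace E) : Prop :=
  (∀ c ∈ L, CurveClass.IsLoop c) ∧ {c ∈ (L : Set (CurveClass E)) | ¬ c.IsTrivial}.Countable

/-- A finite set of curve classes as a point of `LoopSpace E` (finite sets are closed in a
metric space) (Camia–Newman, CMP 268 (2006), §2: discrete loop configurations). [folklore] -/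
def ofFinset (s : Finset (CurveClass E)) : LoopSpace E := ⟨s, s.finite_toSet.isClosed⟩

/-- Membership in `LoopSpace.ofFinset` (Camia–Newman, CMP 268 (2006), §2). [folklore] -/
@[simp] lemma mem_ofFinset {s : Finset (CurveClass E)} {c : CurveClass E} :
    c ∈ ofFinset s ↔ c ∈ s := by
  simp [ofFinset]

/-- A finite set of loops is a loop collection (Camia–Newman, CMP 268 (2006), §2). [folklore] -/
lemma isLoopCollection_ofFinset {s : Finset (CurveClass E)} (h : ∀ c ∈ s, c.IsLoop) :
    (ofFinset s).IsLoopCollection :=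
  ⟨fun c hc ↦ h c (mem_ofFinset.1 hc),
    (s.finite_toSet.subset (sep_subset _ _)).countable⟩

/-- Window restriction: the closure of the sub-collection of curves whose trace stays inside
`S` (Duminil-Copin–Kozlowski–Krachun–Manolescu–Oulamara, arXiv:2012.11672, §1.4: the metric
`d_CN` compares restrictions to bounded windows). For a closed window `S` this is exactly the
sub-collection of members with trace in `S` (`coe_restrict_of_isClosed`); for a general `S` the
closure may re-admit limiting curves whose trace only lies in `closure S`. [cite: arXiv201211672] -/
noncomputable def restrict (S : Set E) (L : LoopSpace E) : LoopSpace E :=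
  .closure {c ∈ (L : Set (CurveClass E)) | c.range ⊆ S}

/-- For a closed window the restricted collection needs no closure
(DKKMO, arXiv:2012.11672, §1.4; `CurveClass.isClosed_rangeSubset`). [cite: arXiv201211672] -/
lemma coe_restrict_of_isClosed {S : Set E} (hS : IsClosed S) (L : LoopSpace E) :
    (restrict S L : Set (CurveClass E)) = {c ∈ (L : Set (CurveClass E)) | c.range ⊆ S} :=
  (L.isClosed.inter (CurveClass.isClosed_rangeSubset hS)).closure_eq

/-- The restricted collection is a sub-collection (DKKMO, arXiv:2012.11672, §1.4). [cite: arXiv201211672] -/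
lemma restrict_le (S : Set E) (L : LoopSpace E) : restrict S L ≤ L :=
  TopologicalSpace.Closeds.closure_le.2 (sep_subset _ _)

/-- Push a loop collection forward along a continuous map `f : C(E, F)`: the closure of the
image under `CurveClass.map f` (Camia–Newman, CMP 268 (2006), §2 and Thm 2: conformal
invariance of the full scaling limit). [folklore] -/
noncomputable def map (f : C(E, F)) (L : LoopSpace E) :
    LoopSpace F :=
  .closure (CurveClass.map f '' (L : Set (CurveClass E)))

/-- The image of a member lies in the pushed-forward collection
(Camia–Newman, CMP 268 (2006), §2). [folklore] -/
lemma map_mem_map (f : C(E, F)) {L : LoopSpace E}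
    {c : CurveClass E} (hc : c ∈ L) : c.map f ∈ map f L :=
  subset_closure (mem_image_of_mem _ hc)

/-- Loop collections in a complete space form a complete emetric space for the Hausdorff
edistance: closed subsets of the complete space `CurveClass E` (`CurveClass.completeSpace` and
Mathlib's `TopologicalSpace.Closeds.instCompleteSpace`) (Aizenman–Burchard, Duke Math. J. 99
(1999), §2.1; Camia–Newman, CMP 268 (2006), §2). A theorem, not an instance (its hypothesis
`CurveClass.completeSpace` is itself a theorem); use via `haveI`. Note that `LoopSpace E` is
*not* separable, hence not Polish, see the module docstring. [folklore] -/
def completeSpace : Prop :=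
  ∀ [CompleteSpace E],
    CompleteSpace (LoopSpace E)

/- interim proof relied on results that are now named facts (D-0014); demoted to a fact by the M5 import, proof preserved:
:= by
  haveI := CurveClass.completeSpace (E := E)
  infer_instance
-/

/-- Discharge of the named fact `LoopSpace.completeSpace` (appended 2026-09-05): for complete `E`
the space `LoopSpace E = Closeds (CurveClass E)` is complete for the Hausdorff edistance, because
`CurveClass E` is then complete (`CurveClass.completeSpace_holds`; an instance in `CurveSpace.lean`)
and the closed subsets of a complete emetric space form a complete space (Mathlib
`TopologicalSpace.Closeds.instCompleteSpace`) — the interim proof preserved above, now valid again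
(Aizenman–Burchard, Duke Math. J. 99 (1999), §2.a p. 12: the space of curves is complete;
Camia–Newman, CMP 268 (2006), §2: collections of loops with the induced Hausdorff metric). [cite: AizenmanBurchardDuke1999, §2.a p. 12 (after eq. (2.2))] -/
theorem completeSpace_holds : completeSpace (E := E) := by
  intro
  infer_instance

end LoopSpace

/-- The distance between laws of random loop collections used to state convergence of loop
ensembles: Mathlib's Lévy–Prokhorov edistance `MeasureTheory.levyProkhorovEDist` on measures
on `LoopSpace E`. This is a proxy for the Camia–Newman metric `d_CN` of
Duminil-Copin–Kozlowski–Krachun–Manolescu–Oulamara (arXiv:2012.11672, §1.4), defined as an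
infimum over couplings of (expected, window-restricted) Hausdorff distances; the Lévy–Prokhorov
edistance is the documented v0 proxy (Camia–Newman, CMP 268 (2006), §2). Stated, like
`levyProkhorovEDist`, for arbitrary measures; it is applied to probability laws. [cite: arXiv201211672] -/
noncomputable abbrev camiaNewmanEDist [MetricSpace E] (μ ν : Measure (LoopSpace E)) : ℝ≥0∞ :=
  levyProkhorovEDist μ ν

/-- The Camia–Newman edistance of a law to itself vanishes
(`MeasureTheory.levyProkhorovEDist_self`; DKKMO, arXiv:2012.11672, §1.4). [cite: arXiv201211672] -/
lemma camiaNewmanEDist_self [MetricSpace E] (μ : Measure (LoopSpace E)) :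
    camiaNewmanEDist μ μ = 0 :=
  levyProkhorovEDist_self μ

/-- The Camia–Newman edistance is symmetric
(`MeasureTheory.levyProkhorovEDist_comm`; DKKMO, arXiv:2012.11672, §1.4). [cite: arXiv201211672] -/
lemma camiaNewmanEDist_comm [MetricSpace E] (μ ν : Measure (LoopSpace E)) :
    camiaNewmanEDist μ ν = camiaNewmanEDist ν μ :=
  levyProkhorovEDist_comm μ ν

end Literature.Probability.RandomPlanarGeometry

-- M5: re-elaborated after the full-build coherence check (05:54Z)
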